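import Summits.CriticalPhenomena.PercolationContinuityZ3.Theorems.PercNearOneGluingAdditiveGluingSetObserverUnfoldDecoy
import Summits.CriticalPhenomena.PercolationContinuityZ3.Theorems.PercNearOneGluingNoHeavyLowerTailMixCSHUnfold
import HarnessLib

/-!
# Conjecture G / SET-W via a SET observer, XIV: the `Σ_j` of Lemma U-set (the decoy terms of the unfolding against the accumulated
# lower-level terms `subTO`)

Support file (`--supports stmt-CriticalPhenomena-4576`); no definitions, no named facts, no sorries.  Seat (b) V⁺-form `png-dp-vplus`, gen 13
(memo MEMO-gen12.md §4(b),(c), §10 (U)).  Set-slot version of the second half of prim-ineq-prove-1's `…NoHeavyLowerTailCSHUnfold.lean`: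
* `covDSet_phiT_eq`, `avoidConstSet_eq_div` — the sub-system covariance `CSHSet.covDSet … (CSH.phiT …) O` and the constants `CSHSet.avoidConstSet`
  at sum level (the centred decoy moments of `…SetObserverUnfoldDecoy`);
  (positivity of the avoidance masses for weights `< 1`: prim seat MixCSH's `MixCSH.sum_ind_avoidEv_ne_zero_of_lt_one`, imported);
* **`sum_wcov_unfoldTO_le`** — for every slot `s` off the decoys, the `{x↮Y}`-average of the world covariance of `g(C_x)` with the unfolded terms
  `unfoldTO` is `≤ −subTO(s)` (induction along the decoy list with a growing source set; the set slot contributes the defect inequality);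
  **`sum_wcov_unfoldTO_some`** — equality at a vertex slot (verbatim `CSH.sum_wcov_unfoldT`).
[cite: VandenbergHaggstromKahn2005, §2.1 Lemma 2.4 (p. 10); §1 display (10) (pp. 7–8) — corollaries]
-/

noncomputable section

namespace Summit.CriticalPhenomena.PercolationContinuityZ3.Theorems

open MeasureTheory Set Literature.Probability.LatticeModels Literature.Probability.Percolation
open scoped Classical

namespace CSHSet

open CSH HullPort BHK2006 DecisionTree

variable {V : Type*} [Fintype V]

/-! ### Dictionary: the sub-system covariance and constants at sum level -/

/-- **The denominator-free covariance of the sub-system with a set slot is the centred decoy moment**: for `E = {d ↮ A}`,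
`covDSet_{d,A}(Φ̃_d)(s') = m₀·P₁(s') − m₁(s')·P₀` (masses and `Φ`-moments at sum level; set version of `CSH.covD_phiT_eq`). [folklore] -/
theorem covDSet_phiT_eq (w : Sym2 V → unitInterval) (x : V) (Y A : Set V) (g : Set (Sym2 V) → ℝ) (O : Finset V) (d : V)
    (s' : Option V) :
    covDSet w d A (phiT w x Y g d) O s' =
      (∑ ζ, weight (fun e => (w e : ℝ)) ζ * ind (avoidEv d A) ζ) *
          (∑ ζ, weight (fun e => (w e : ℝ)) ζ *
            (ind (avoidEv d A ∩ slotEv O d A s') ζ * phiS (fun e => (w e : ℝ)) x Y g d ζ)) -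
        (∑ ζ, weight (fun e => (w e : ℝ)) ζ * ind (avoidEv d A ∩ slotEv O d A s') ζ) *
          (∑ ζ, weight (fun e => (w e : ℝ)) ζ * (ind (avoidEv d A) ζ * phiS (fun e => (w e : ℝ)) x Y g d ζ)) := by
  unfold covDSet
  rw [TwoAvoidanceSets.real_eq_sum_ind, TwoAvoidanceSets.real_eq_sum_ind, setIntegral_eq_sum_ind, setIntegral_eq_sum_ind]
  simp only [phiT_openEdgeCluster]
  have hE : ({ω : BondConfig V | ∀ y ∈ A, ¬ (openGraph ω).Reachable d y} : Set (Set (Sym2 V))) = avoidEv d A := rfl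
  rw [hE]
  ring

/-- **The decoy constant with a set slot is the ratio of masses** (sum level; set version of `CSH.avoidConst_eq_div`). [folklore] -/
theorem avoidConstSet_eq_div (w : Sym2 V → unitInterval) (O : Finset V) (d : V) (A : Set V) (s' : Option V) :
    avoidConstSet w O d A s' = (∑ ζ, weight (fun e => (w e : ℝ)) ζ * ind (avoidEv d A ∩ slotEv O d A s') ζ) /
      ∑ ζ, weight (fun e => (w e : ℝ)) ζ * ind (avoidEv d A) ζ := by
  unfold avoidConstSet
  rw [TwoAvoidanceSets.real_eq_sum_ind, TwoAvoidanceSets.real_eq_sum_ind]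
  rfl

/-! ### Summing the decoy terms along the list (the `Σ_j` of Lemma U-set) -/

/-- **The `Σ_j` of Lemma U-set, upper bound at every slot** (set version of `CSH.sum_wcov_unfoldT`): the `{x↮Y}`-average of the world
covariance of `g(C_x)` with the unfolded terms `unfoldTO` (read in the world, liveness factor `ℓ(C_Y(ω))`) is AT MOST minus the accumulated
lower-level terms `subTO`.  Hypotheses: weights `< 1`, `x ∈ S`, the decoys distinct, outside `S ∪ Y ∪ O` and different from the slot `s`.
(transcription of the cell memo png-dp-vplus MEMO-gen12.md §4(b),(c)) [cite: VandenbergHaggstromKahn2005, §2.1 Lemma 2.4 (p. 10) — corollary] -/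
theorem sum_wcov_unfoldTO_le (w : Sym2 V → unitInterval) (hw : ∀ e, w e < 1) (x : V) (Y : Set V)
    (g : Set (Sym2 V) → ℝ) (hg : Monotone g) (O : Finset V) (s : Option V)
    (ℓ : Set (Sym2 V) → ℝ) (hℓ : ∀ ζ' : Set (Sym2 V), ℓ (setCl ζ' Y) = ind {β : Set (Sym2 V) | ∀ o ∈ O, β ∈ avoidEv o Y} ζ') :
    ∀ (D : List V) (S : Set V), x ∈ S → D.Nodup → (∀ d ∈ D, d ∉ S ∧ d ∉ Y ∧ some d ≠ s ∧ d ∉ O) →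
      ∑ ω, weight (fun e => (w e : ℝ)) ω * (ind (avoidEv x Y) ω *
          wcovOff (fun e => (w e : ℝ)) Y (fun β => g (openEdgeCluster β x))
            (fun ζ => unfoldTO (openGraph ζ).Reachable O (ℓ (setCl ω Y)) S (decoyListSet w O (S ∪ Y) D) s) ω) ≤
        - subTO w x Y g O s S D := by
  intro D
  induction D with
  | nil =>
    intro S _ _ _
    simp only [decoyListSet_nil, unfoldTO_nil, subTO_nil, neg_zero]
    exact le_of_eq (Finset.sum_eq_zero fun ω _ => by rw [wcovOff_zero_right]; ring)
  | cons d ds ih =>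
    intro S hxS hnd hdis
    set ŵ : Sym2 V → ℝ := fun e => (w e : ℝ) with hŵ
    have hw0 : ∀ e, 0 ≤ ŵ e := fun e => (w e).2.1
    have hw1 : ∀ e, ŵ e ≤ 1 := fun e => (w e).2.2
    have hm : ∑ ω, weight ŵ ω = 1 := by
      have h1 := integral_prodBernoulli_eq_sum w fun _ => (1 : ℝ)
      simp only [integral_const, probReal_univ, smul_eq_mul, mul_one] at h1
      exact h1.symm
    have hdS : d ∉ S := (hdis d List.mem_cons_self).1
    have hdY : d ∉ Y := (hdis d List.mem_cons_self).2.1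
    have hsd : s ≠ some d := fun h => (hdis d List.mem_cons_self).2.2.1 h.symm
    have hdO : d ∉ O := (hdis d List.mem_cons_self).2.2.2
    have hnd' : ds.Nodup := (List.nodup_cons.1 hnd).2
    have hd_notin : d ∉ ds := (List.nodup_cons.1 hnd).1
    -- the list unfolds at the head
    have hL : decoyListSet w O (S ∪ Y) (d :: ds) =
        (some d, avoidConstSet w O d (S ∪ Y)) :: decoyListSet w O (insert d (S ∪ Y)) ds := rfl
    have hset : insert d (S ∪ Y) = insert d S ∪ Y := by rw [Set.insert_union]
    have hheads := decoyListSet_heads w O (insert d (S ∪ Y)) ds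
    have hL' := decoyListSet_heads_ne w O (insert d (S ∪ Y)) hd_notin
    have hm₀ : ∑ ζ, weight ŵ ζ * ind (avoidEv d (S ∪ Y)) ζ ≠ 0 :=
      MixCSH.sum_ind_avoidEv_ne_zero_of_lt_one w hw (fun h => h.elim hdS hdY)
    -- split the test function
    have hsplit : ∀ ω, wcovOff ŵ Y (fun β => g (openEdgeCluster β x))
        (fun ζ => unfoldTO (openGraph ζ).Reachable O (ℓ (setCl ω Y)) S (decoyListSet w O (S ∪ Y) (d :: ds)) s) ω =
        wcovOff ŵ Y (fun β => g (openEdgeCluster β x))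
          (fun ζ => av (openGraph ζ).Reachable S d *
            slForm (decoyListSet w O (insert d (S ∪ Y)) ds) (fun s' => chiO (openGraph ζ).Reachable O (ℓ (setCl ω Y)) S d s' -
              avoidConstSet w O d (S ∪ Y) s') s) ω +
        wcovOff ŵ Y (fun β => g (openEdgeCluster β x))
          (fun ζ => unfoldTO (openGraph ζ).Reachable O (ℓ (setCl ω Y)) (insert d S) (decoyListSet w O (insert d S ∪ Y) ds) s) ω := by
      intro ω
      rw [← wcovOff_add_right, hL]
      simp only [unfoldTO_cons_some, hset]
    -- the head term: `decoy_world_term_set_le`, rewritten with `covDSet_{d}(Φ̃_d)`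
    have hhead := decoy_world_term_set_le ŵ hw0 hw1 hm x Y g hg O hxS hdS hdO (decoyListSet w O (insert d (S ∪ Y)) ds) hheads hL'
      hsd (avoidConstSet w O d (S ∪ Y)) ℓ hℓ hm₀ (fun s' => avoidConstSet_eq_div w O d (S ∪ Y) s')
    have hQ : (fun s' =>
        (∑ ζ, weight ŵ ζ * ind (avoidEv d (S ∪ Y)) ζ) *
            (∑ ζ, weight ŵ ζ * (ind (avoidEv d (S ∪ Y) ∩ slotEv O d (S ∪ Y) s') ζ * phiS ŵ x Y g d ζ)) -
          (∑ ζ, weight ŵ ζ * ind (avoidEv d (S ∪ Y) ∩ slotEv O d (S ∪ Y) s') ζ) *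
            (∑ ζ, weight ŵ ζ * (ind (avoidEv d (S ∪ Y)) ζ * phiS ŵ x Y g d ζ))) =
        covDSet w d (S ∪ Y) (phiT w x Y g d) O := by
      funext s'; rw [covDSet_phiT_eq]
    rw [hQ, ← TwoAvoidanceSets.real_eq_sum_ind] at hhead
    -- the tail by the induction hypothesis at the source set `S ∪ {d}`
    have htail := ih (insert d S) (Set.mem_insert_of_mem d hxS) hnd' (fun e he =>
      ⟨fun h' => (Set.mem_insert_iff.1 h').elim (fun h0 => hd_notin (h0 ▸ he)) (hdis e (List.mem_cons_of_mem d he)).1,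
        (hdis e (List.mem_cons_of_mem d he)).2.1, (hdis e (List.mem_cons_of_mem d he)).2.2.1,
        (hdis e (List.mem_cons_of_mem d he)).2.2.2⟩)
    have e : ∀ ω, weight ŵ ω * (ind (avoidEv x Y) ω * wcovOff ŵ Y (fun β => g (openEdgeCluster β x))
        (fun ζ => unfoldTO (openGraph ζ).Reachable O (ℓ (setCl ω Y)) S (decoyListSet w O (S ∪ Y) (d :: ds)) s) ω) =
        weight ŵ ω * (ind (avoidEv x Y) ω * wcovOff ŵ Y (fun β => g (openEdgeCluster β x))
          (fun ζ => av (openGraph ζ).Reachable S d *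
            slForm (decoyListSet w O (insert d (S ∪ Y)) ds) (fun s' => chiO (openGraph ζ).Reachable O (ℓ (setCl ω Y)) S d s' -
              avoidConstSet w O d (S ∪ Y) s') s) ω) +
        weight ŵ ω * (ind (avoidEv x Y) ω * wcovOff ŵ Y (fun β => g (openEdgeCluster β x))
          (fun ζ => unfoldTO (openGraph ζ).Reachable O (ℓ (setCl ω Y)) (insert d S) (decoyListSet w O (insert d S ∪ Y) ds) s) ω) := by
      intro ω; rw [hsplit]; ring
    rw [Finset.sum_congr rfl (fun ω _ => e ω), Finset.sum_add_distrib, subTO_cons, neg_add]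
    exact add_le_add hhead htail

/-- **The `Σ_j` of Lemma U-set at a vertex slot, exact** (verbatim `CSH.sum_wcov_unfoldT`: a vertex slot does not read the set slot).
(transcription of the cell memo png-dp-vplus MEMO-gen12.md §4(b)) [cite: VandenbergHaggstromKahn2005, §2.1 Lemma 2.4 (p. 10) — corollary] -/
theorem sum_wcov_unfoldTO_some (w : Sym2 V → unitInterval) (hw : ∀ e, w e < 1) (x : V) (Y : Set V)
    (g : Set (Sym2 V) → ℝ) (O : Finset V) (u : V)
    (ℓ : Set (Sym2 V) → ℝ) (hℓ : ∀ ζ' : Set (Sym2 V), ℓ (setCl ζ' Y) = ind {β : Set (Sym2 V) | ∀ o ∈ O, β ∈ avoidEv o Y} ζ') :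
    ∀ (D : List V) (S : Set V), x ∈ S → D.Nodup → (∀ d ∈ D, d ∉ S ∧ d ∉ Y ∧ d ≠ u ∧ d ∉ O) →
      ∑ ω, weight (fun e => (w e : ℝ)) ω * (ind (avoidEv x Y) ω *
          wcovOff (fun e => (w e : ℝ)) Y (fun β => g (openEdgeCluster β x))
            (fun ζ => unfoldTO (openGraph ζ).Reachable O (ℓ (setCl ω Y)) S (decoyListSet w O (S ∪ Y) D) (some u)) ω) =
        - subTO w x Y g O (some u) S D := by
  intro D
  induction D with
  | nil =>
    intro S _ _ _
    simp only [decoyListSet_nil, unfoldTO_nil, subTO_nil, neg_zero]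
    exact Finset.sum_eq_zero fun ω _ => by rw [wcovOff_zero_right]; ring
  | cons d ds ih =>
    intro S hxS hnd hdis
    set ŵ : Sym2 V → ℝ := fun e => (w e : ℝ) with hŵ
    have hm : ∑ ω, weight ŵ ω = 1 := by
      have h1 := integral_prodBernoulli_eq_sum w fun _ => (1 : ℝ)
      simp only [integral_const, probReal_univ, smul_eq_mul, mul_one] at h1
      exact h1.symm
    have hdS : d ∉ S := (hdis d List.mem_cons_self).1
    have hdY : d ∉ Y := (hdis d List.mem_cons_self).2.1
    have hud : u ≠ d := fun h => (hdis d List.mem_cons_self).2.2.1 h.symm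
    have hdO : d ∉ O := (hdis d List.mem_cons_self).2.2.2
    have hnd' : ds.Nodup := (List.nodup_cons.1 hnd).2
    have hd_notin : d ∉ ds := (List.nodup_cons.1 hnd).1
    have hL : decoyListSet w O (S ∪ Y) (d :: ds) =
        (some d, avoidConstSet w O d (S ∪ Y)) :: decoyListSet w O (insert d (S ∪ Y)) ds := rfl
    have hset : insert d (S ∪ Y) = insert d S ∪ Y := by rw [Set.insert_union]
    have hheads := decoyListSet_heads w O (insert d (S ∪ Y)) ds
    have hL' := decoyListSet_heads_ne w O (insert d (S ∪ Y)) hd_notin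
    have hm₀ : ∑ ζ, weight ŵ ζ * ind (avoidEv d (S ∪ Y)) ζ ≠ 0 :=
      MixCSH.sum_ind_avoidEv_ne_zero_of_lt_one w hw (fun h => h.elim hdS hdY)
    have hsplit : ∀ ω, wcovOff ŵ Y (fun β => g (openEdgeCluster β x))
        (fun ζ => unfoldTO (openGraph ζ).Reachable O (ℓ (setCl ω Y)) S (decoyListSet w O (S ∪ Y) (d :: ds)) (some u)) ω =
        wcovOff ŵ Y (fun β => g (openEdgeCluster β x))
          (fun ζ => av (openGraph ζ).Reachable S d *
            slForm (decoyListSet w O (insert d (S ∪ Y)) ds) (fun s' => chiO (openGraph ζ).Reachable O (ℓ (setCl ω Y)) S d s' -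
              avoidConstSet w O d (S ∪ Y) s') (some u)) ω +
        wcovOff ŵ Y (fun β => g (openEdgeCluster β x))
          (fun ζ => unfoldTO (openGraph ζ).Reachable O (ℓ (setCl ω Y)) (insert d S) (decoyListSet w O (insert d S ∪ Y) ds) (some u)) ω := by
      intro ω
      rw [← wcovOff_add_right, hL]
      simp only [unfoldTO_cons_some, hset]
    have hhead := decoy_world_term_set_some ŵ hm x Y g O hxS hdS hdO (decoyListSet w O (insert d (S ∪ Y)) ds) hheads hL'
      hud (avoidConstSet w O d (S ∪ Y)) ℓ hℓ hm₀ (fun s' => avoidConstSet_eq_div w O d (S ∪ Y) s')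
    have hQ : (fun s' =>
        (∑ ζ, weight ŵ ζ * ind (avoidEv d (S ∪ Y)) ζ) *
            (∑ ζ, weight ŵ ζ * (ind (avoidEv d (S ∪ Y) ∩ slotEv O d (S ∪ Y) s') ζ * phiS ŵ x Y g d ζ)) -
          (∑ ζ, weight ŵ ζ * ind (avoidEv d (S ∪ Y) ∩ slotEv O d (S ∪ Y) s') ζ) *
            (∑ ζ, weight ŵ ζ * (ind (avoidEv d (S ∪ Y)) ζ * phiS ŵ x Y g d ζ))) =
        covDSet w d (S ∪ Y) (phiT w x Y g d) O := by
      funext s'; rw [covDSet_phiT_eq]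
    rw [hQ, ← TwoAvoidanceSets.real_eq_sum_ind] at hhead
    have htail := ih (insert d S) (Set.mem_insert_of_mem d hxS) hnd' (fun e he =>
      ⟨fun h' => (Set.mem_insert_iff.1 h').elim (fun h0 => hd_notin (h0 ▸ he)) (hdis e (List.mem_cons_of_mem d he)).1,
        (hdis e (List.mem_cons_of_mem d he)).2.1, (hdis e (List.mem_cons_of_mem d he)).2.2.1,
        (hdis e (List.mem_cons_of_mem d he)).2.2.2⟩)
    have e : ∀ ω, weight ŵ ω * (ind (avoidEv x Y) ω * wcovOff ŵ Y (fun β => g (openEdgeCluster β x))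
        (fun ζ => unfoldTO (openGraph ζ).Reachable O (ℓ (setCl ω Y)) S (decoyListSet w O (S ∪ Y) (d :: ds)) (some u)) ω) =
        weight ŵ ω * (ind (avoidEv x Y) ω * wcovOff ŵ Y (fun β => g (openEdgeCluster β x))
          (fun ζ => av (openGraph ζ).Reachable S d *
            slForm (decoyListSet w O (insert d (S ∪ Y)) ds) (fun s' => chiO (openGraph ζ).Reachable O (ℓ (setCl ω Y)) S d s' -
              avoidConstSet w O d (S ∪ Y) s') (some u)) ω) +
        weight ŵ ω * (ind (avoidEv x Y) ω * wcovOff ŵ Y (fun β => g (openEdgeCluster β x))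
          (fun ζ => unfoldTO (openGraph ζ).Reachable O (ℓ (setCl ω Y)) (insert d S) (decoyListSet w O (insert d S ∪ Y) ds) (some u)) ω) := by
      intro ω; rw [hsplit]; ring
    rw [Finset.sum_congr rfl (fun ω _ => e ω), Finset.sum_add_distrib, hhead, htail, subTO_cons, hset]
    ring

end CSHSet

end Summit.CriticalPhenomena.PercolationContinuityZ3.Theorems

end
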